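import Summits.QuantumFields.YangMills.Theorems.BalabanUVNodesN18CornerBandOfKernelLettersRecord
import Summits.QuantumFields.YangMills.Theorems.BalabanUVNodesN18CornerKernelsOfKernelLetters
import Literature.MathematicalPhysics.QuantumFieldTheory.Balaban1983to89.Beta.Drift

/-!
# BalabanUVNodes ∕ N18 — THE CORNER DRIFT: K3⁷'s three node-U3 kernel letters (N22's kernel NE9, (D4)'s (5.10) clause, N18's `KernelStepRate`) make the β of record's CORNER
# NUMBERS anchor it per scale AND drift at their limit slope — the SIGN-FREE BODY of K2⁷ v7c's registered stub 2ᶜᴰ `CornerDriftPos` at a tuple; plus the corner SIGN in PORT-1's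
# κ-free limit form this is 2ᶜᴰ's conclusion at that tuple, END-free and v₀-free
# (Track A, DAG node N18 = NE5, in-edge to N17 = node U3 → node U2; key K3⁷ `SpineGivenEndpointR13SepCoPH` = stmt-QuantumFields-20544 (v5 941dddb108cbaacf); serves K2⁷ =
# stmt-QuantumFields-20543 v7c 795c9e8285fed415 BY NAME only; width seat `pub-ymgap-dag-n18-w1` g4, FILE 4 of the corner series: FILE 1 p612254 · FILE 2 p613620 · FILE 3 `…CornerKernelsOfKernelLetters`)

HONEST FRAMING.  Count-neutral kernel bookkeeping BY NAME (`--kind proof --supports stmt-QuantumFields-20544 --as helper`).  Two elementary real lemmas (a summable geometric tail is a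
drift at the limit slope; a geometric rate tends to its limit) + compositions of FILE 2's `exists_cornerNumbers_betaOfRecord₁₃_of_kernelNE9` and FILE 3's
`cornerNumbers_record_geometric_of_kernelLetters` (uniqueness of the diagonal limit identifies the two corner sequences).  Kernel NE9, the (5.10) clause, N18's `KernelStepRate` (NE5 NOT
PRINTED for d = 4) and the corner SIGN are DISPLAYED HYPOTHESES inhabited at no θ here — nothing of Bałaban's is asserted; NO sign, value or identification of the corner numbers is claimed;
K2⁷ v7c's `stub_cornerDriftPos13` ∕ `stub_runChainCornerSlope13` and K3⁷'s `stub_rates13H` ∕ `stub_expansion13H` are NOT proved; nothing registered, no skeleton touched; DEF-1's `ScaleAnchor`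
spelled INLINE (δ-unfolds), `OneLoopDrift` = `Beta.Drift`'s def by name; PORT-1's `…K2CornerRoad.oneLoopDrift_of_geometric` (θ^k form) cited, not imported (Theses cone).  N17 ∕ N18 ∕ N22
NOT discharged; K2⁷ ∕ K3⁷ OPEN; counts UNMOVED (typed 28∕28 · discharged 5∕27, A 5∕28).  One finite four-torus programme at fixed `ε`, Bałaban AS PRINTED; route R4 closes ONLY the
conditional finite-𝕋⁴ rung `BalabanLadder.UV` — NOT the continuum limit, NOT ℝ⁴, NOT OS, NOT the Yang–Mills mass gap, NOT Clay.  THEOREMS ONLY: 0 `def`, 0 `instance`, 0 `sorry`, std axioms.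

WHY.  Plan g84 registered K2⁷ v7c (07:44:57Z) in the CORNER keying: 2ᶜᴰ `CornerDriftPos` = under the crux's prefix `∃ b s A, ScaleAnchor D.βfun b ∧ 0 < s ∧ OneLoopDrift s A b` at
`D = datumOfRecord₁₃SepCoPH F 2 θ hP`, its docstring naming «corner-limit existence — U3∕N18 lane by name».  FILES 1–3 built exactly that lane's letter-currency corner: the corner numbers
exist and anchor β from N22's letter alone (FILE 2, no `hadm`), and by the KERNEL ROAD N18's letter makes them converge geometrically to `secondMoment Π⁰_∞ 0 1` (FILE 3).  This file
closes the square: geometric convergence IS a drift at the limit slope, so at every Stage-13 tuple the three kernel letters give 2ᶜᴰ's body WITHOUT its sign, and the sign of the limit —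
PORT-1's κ-free `CornerLimPosᴷ` letter read at the tuple — is the ONE remaining bit.  (dag-n17-w1 g4's p613927 is the CONSUMER side: 2ᶜᴰ ⟹ END via node N17's road.)

WHAT (theorems only).
* §1 `oneLoopDrift_of_abs_sub_le_geometric_succ` (`|b_k − b_∞| ≤ Cθ^{k+1}`, `0 ≤ θ < 1`, `0 ≤ C` ⟹ `OneLoopDrift b_∞ (Cθ(1−θ)⁻¹) b`) · `tendsto_of_abs_sub_le_geometric_succ`.
* §2 AT THE RECORD: ★★ `cornerDrift_record_of_kernelLetters` (`θ : Stage13Params`, `ℓ.Signs`, `0 < θ.γ`, `0 < ℓ.κ`, v5 §2b (i) `h9`, (iii) `hdec`, N18's `KernelStepRateOfRecord₁₃ F N θ ℓ.κ ℓ.θ₅ ℓ.C₅`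
  ⟹ ∃ b b_∞: diagonal limits ∧ per-scale ANCHOR of `betaOfRecord₁₃ F N θ` at `b` ∧ `b → b_∞` ∧ `OneLoopDrift b_∞ (ℓ.C₅(1−ℓ.θ₅)⁻¹·betaPrime510 4 1 ℓ.κ·ℓ.θ₅·(1−ℓ.θ₅)⁻¹) b`) ·
  ★★★ `cornerDriftPos_at_of_kernelLetters_of_cornerLimPos` (`θ : Stage13HParams`, `hP : θ.Provisos₁₃SepCoPH F N`; + the corner sign in limit form at the tuple ⟹
  `∃ b s A, ‹ScaleAnchor (datumOfRecord₁₃SepCoPH F N θ hP).βfun b› ∧ 0 < s ∧ OneLoopDrift s A b` — 2ᶜᴰ's conclusion at the tuple, any `N`).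

References (TYPES ∕ locators only): [Balaban1987RG1] CMP **109** (1987): Thm 1 p. 259 (NE5 NOT printed), Thm 3 p. 264, (1.3) p. 260, (1.20)–(1.22) p. 264, (2.12)–(2.14) p. 268, (5.10) p. 293.
-/

noncomputable section

open Filter Topology
open scoped BigOperators NNReal

namespace YMDAG.N18.CornerDriftOfKernelLetters

open Literature.MathematicalPhysics.QuantumFieldTheory.Balaban1983to89
open Literature.MathematicalPhysics.QuantumFieldTheory.Balaban1983to89.T4Continuum (T4Family)
open Literature.MathematicalPhysics.QuantumFieldTheory.Balaban1983to89.T4OutputRate (Window NE9)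
open Literature.MathematicalPhysics.QuantumFieldTheory.Balaban1983to89.FlowStep (Box HBeta mem_box)
open Literature.MathematicalPhysics.QuantumFieldTheory.Balaban1983to89.B12Beta (HistBox)
open Literature.MathematicalPhysics.QuantumFieldTheory.Balaban1983to89.Beta.Drift (OneLoopDrift)
open Literature.MathematicalPhysics.QuantumFieldTheory.Balaban1983to89.Node00 (betaOfRecord₁₃ Stage13Params Stage13HParams U3Letters₁₁ datumOfRecord₁₃SepCoPH)
open Literature.MathematicalPhysics.QuantumFieldTheory.Balaban1983to89.Node00.U3OfKernels (objectsOfRecord₁₃ KernelDecayOfRecord₁₃)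
open Literature.MathematicalPhysics.QuantumFieldTheory.Balaban1983to89.Node00.U3KernelLetters (KernelStepRateOfRecord₁₃)
open Literature.MathematicalPhysics.QuantumFieldTheory.Balaban1983to89.B12Sec2to5 (betaPrime510)
open YMDAG.N18.CornerBandOfKernelLetters (exists_cornerNumbers_betaOfRecord₁₃_of_kernelNE9)
open YMDAG.N18.CornerKernelsOfKernelLetters (cornerNumbers_record_geometric_of_kernelLetters)
open YMDAG.N18.RemainderBandOfKernelLetters (betaPrime510_four_one_nonneg)

/-! ## §1 Geometric convergence ⟹ drift at the limit slope (the `(k+1)`-power form used by the kernel road) -/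

/-- **GEOMETRIC CONVERGENCE IS A DRIFT AT THE LIMIT SLOPE**: `|b_k − b_∞| ≤ C·θ^{k+1}` (`0 ≤ θ < 1`, `0 ≤ C`) gives `OneLoopDrift b_∞ (C·θ·(1−θ)⁻¹) b`, i.e. `|Σ_{j<k} b_j − b_∞·k| ≤ Cθ∕(1−θ)`
for every `k` (the partial sums of a summable geometric tail).  PORT-1's `…K2CornerRoad.oneLoopDrift_of_geometric` is the `θ^k`-power twin (cited; this form matches FILE 3's rates).
[cite: Balaban1987RG1, (1.3) p.260 and (1.22) p.264] -/
theorem oneLoopDrift_of_abs_sub_le_geometric_succ {b : ℕ → ℝ} {binf C θ : ℝ} (hθ0 : 0 ≤ θ) (hθ1 : θ < 1) (hC : 0 ≤ C)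
    (hrate : ∀ k : ℕ, |b k - binf| ≤ C * θ ^ (k + 1)) : OneLoopDrift binf (C * θ * (1 - θ)⁻¹) b := by
  intro k
  have e : ∑ j ∈ Finset.range k, b j - binf * k = ∑ j ∈ Finset.range k, (b j - binf) := by
    rw [Finset.sum_sub_distrib, Finset.sum_const, Finset.card_range, nsmul_eq_mul, mul_comm]
  rw [e]
  have hgeom : ∑ j ∈ Finset.range k, θ ^ j ≤ (1 - θ)⁻¹ :=
    sum_le_hasSum _ (fun i _ => pow_nonneg hθ0 i) (hasSum_geometric_of_lt_one hθ0 hθ1)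
  calc |∑ j ∈ Finset.range k, (b j - binf)| ≤ ∑ j ∈ Finset.range k, |b j - binf| := Finset.abs_sum_le_sum_abs _ _
    _ ≤ ∑ j ∈ Finset.range k, C * θ ^ (j + 1) := Finset.sum_le_sum fun j _ => hrate j
    _ = C * θ * ∑ j ∈ Finset.range k, θ ^ j := by
        rw [Finset.mul_sum]
        refine Finset.sum_congr rfl fun j _ => ?_
        ring
    _ ≤ C * θ * (1 - θ)⁻¹ := mul_le_mul_of_nonneg_left hgeom (mul_nonneg hC hθ0)

/-- A geometric rate with ratio `< 1` tends to its limit. [folklore] -/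
theorem tendsto_of_abs_sub_le_geometric_succ {b : ℕ → ℝ} {binf C θ : ℝ} (hθ0 : 0 ≤ θ) (hθ1 : θ < 1)
    (hrate : ∀ k : ℕ, |b k - binf| ≤ C * θ ^ (k + 1)) : Tendsto b atTop (𝓝 binf) := by
  have h0 : Tendsto (fun k : ℕ => C * θ ^ (k + 1)) atTop (𝓝 0) := by
    have h := (tendsto_pow_atTop_nhds_zero_of_lt_one hθ0 hθ1).comp (tendsto_add_atTop_nat 1)
    have h' : Tendsto (fun k : ℕ => C * θ ^ (k + 1)) atTop (𝓝 (C * 0)) := tendsto_const_nhds.mul h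
    rwa [mul_zero] at h'
  have key : ∀ᶠ k in atTop, ‖b k - binf‖ ≤ C * θ ^ (k + 1) := Eventually.of_forall fun k => by
    rw [Real.norm_eq_abs]; exact hrate k
  exact tendsto_sub_nhds_zero_iff.1 (squeeze_zero_norm' key h0)

/-! ## §2 At the record, Stage 13: the β of record's corner numbers ANCHOR it AND DRIFT at their limit — from K3⁷'s three kernel letters (sign-free body of K2⁷ v7c's 2ᶜᴰ) -/

section Record

open scoped Matrix.Norms.L2Operator

variable (F : T4Family) (N : ℕ) [NeZero N]

/-- ★★ **THE SIGN-FREE BODY OF K2⁷ v7c's STUB 2ᶜᴰ AT A STAGE-13 TUPLE, FROM K3⁷'s THREE KERNEL LETTERS** (FILE 2 + FILE 3): for `θ` with `0 < θ.γ`, a letter block `ℓ` with `ℓ.Signs` and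
`0 < ℓ.κ`, kernel NE9 of the functional of record (v5 §2b (i) `h9`), the (5.10) clause of record (§2b (iii) `hdec`) and N18's letter of record `KernelStepRateOfRecord₁₃ F N θ ℓ.κ ℓ.θ₅ ℓ.C₅`:
the β of record `betaOfRecord₁₃ F N θ` has corner numbers `b` (diagonal limits) which (a) ANCHOR it per scale (DEF-1's `ScaleAnchor`, unfolded), (b) CONVERGE to a limit `b_∞` and (c) DRIFT at
the slope `b_∞` with bounded deviation `A = ℓ.C₅·ℓ.θ₅²·betaPrime510 4 1 ℓ.κ∕(1−ℓ.θ₅)²` (`OneLoopDrift b_∞ A b`).  What 2ᶜᴰ asks BEYOND this is ONE SIGN: `0 < b_∞`.  LOCATED: the three letters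
displayed (N18 ∕ N22 ∕ (D4) content), inhabited at no θ; nothing of Bałaban asserted; 2ᶜᴰ ∕ `stub_rates13H` NOT proved; N17∕N18∕N22 NOT discharged.
[cite: Balaban1987RG1, Thm 1 p.259, (1.3) p.260, (1.20)-(1.22) p.264, (2.12)-(2.14) p.268 and (5.10) p.293] -/
theorem cornerDrift_record_of_kernelLetters (θ : Stage13Params F N) (ℓ : U3Letters₁₁) (hs : ℓ.Signs) (hγ : 0 < θ.γ) (hκ : 0 < ℓ.κ)
    (h9 : NE9 ((objectsOfRecord₁₃ F N θ ℓ).EA 0) (Window θ.γ) ℓ.κ ℓ.moduli) (hdec : KernelDecayOfRecord₁₃ F N θ 0 1 ℓ.κ)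
    (h18 : KernelStepRateOfRecord₁₃ F N θ ℓ.κ ℓ.θ₅ ℓ.C₅) :
    ∃ (b : ℕ → ℝ) (binf : ℝ),
      (∀ k : ℕ, Tendsto (fun t : ℝ => betaOfRecord₁₃ F N θ k (fun _ : Fin (k + 1) => t)) (𝓝[>] (0 : ℝ)) (𝓝 (b k))) ∧
      (∀ (k : ℕ) (δ : ℝ), 0 < δ → ∃ γ' : ℝ, 0 < γ' ∧ ∀ p : Fin (k + 1) → ℝ, p ∈ HistBox γ' k → |betaOfRecord₁₃ F N θ k p - b k| ≤ δ) ∧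
      Tendsto b atTop (𝓝 binf) ∧
      OneLoopDrift binf (ℓ.C₅ / (1 - ℓ.θ₅) * betaPrime510 4 1 ℓ.κ * ℓ.θ₅ * (1 - ℓ.θ₅)⁻¹) b := by
  obtain ⟨b, hT, hA, -⟩ := exists_cornerNumbers_betaOfRecord₁₃_of_kernelNE9 F N θ ℓ hγ hκ h9 hdec
  obtain ⟨c, cinf, hcT, -, hrate⟩ := cornerNumbers_record_geometric_of_kernelLetters F N θ ℓ hs hγ hκ h9 hdec h18
  -- the two diagonal readings coincide
  have hbc : ∀ k, b k = c k := fun k => tendsto_nhds_unique (hT k) (hcT k)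
  have hrate' : ∀ k : ℕ, |b k - cinf| ≤ ℓ.C₅ / (1 - ℓ.θ₅) * betaPrime510 4 1 ℓ.κ * ℓ.θ₅ ^ (k + 1) := fun k => by
    rw [hbc k]
    refine (hrate k).trans (le_of_eq ?_)
    ring
  have hC : 0 ≤ ℓ.C₅ / (1 - ℓ.θ₅) * betaPrime510 4 1 ℓ.κ :=
    mul_nonneg (div_nonneg hs.C₅_nonneg (sub_nonneg.2 hs.θ₅_lt_one.le)) (betaPrime510_four_one_nonneg ℓ.κ)
  exact ⟨b, cinf, hT, hA, tendsto_of_abs_sub_le_geometric_succ hs.θ₅_pos.le hs.θ₅_lt_one hrate',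
    oneLoopDrift_of_abs_sub_le_geometric_succ hs.θ₅_pos.le hs.θ₅_lt_one hC hrate'⟩

/-- ★★★ **K2⁷ v7c STUB 2ᶜᴰ's CONCLUSION AT A TUPLE ⇐ K3⁷'s THREE KERNEL LETTERS + THE CORNER SIGN** (plan g84, skeleton v7c 795c9e8285fed415: `CornerDriftPos` reads, under the crux's prefix,
`∃ b s A, ScaleAnchor (datumOfRecord₁₃SepCoPH F 2 θ hP).βfun b ∧ 0 < s ∧ OneLoopDrift s A b`; its docstring names «corner-limit existence — U3∕N18 lane by name»).  Here, at ANY `N` and ANY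
Stage-13 tuple `(θ, hP)` (the prefix is not read): the kernel letters at `θ.toStage13Params` give `b`, its anchor and its drift at the limit slope `b_∞` (previous theorem; the datum's `βfun`
IS `betaOfRecord₁₃ F N θ.toStage13Params`, `rfl`), and PORT-1's κ-free CORNER-SIGN letter in LIMIT FORM («every anchoring sequence with a limit has a positive limit» — `CornerLimPosᴷ` of
`…K2CornerRoadSign` §4, read AT THIS TUPLE) supplies `0 < b_∞`.  So 2ᶜᴰ = (K3⁷'s node-U3 kernel letters, END-free) + ONE SIGN per tuple.  `ScaleAnchor` spelled inline (δ-unfolds to DEF-1's).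
LOCATED: letters and sign displayed; 2ᶜᴰ NOT proved; nothing registered here. [cite: Balaban1987RG1, Thm 3 p.264, (1.3) p.260, (2.12)-(2.14) p.268 and (5.10) p.293] -/
theorem cornerDriftPos_at_of_kernelLetters_of_cornerLimPos (θ : Stage13HParams F N) (hP : θ.Provisos₁₃SepCoPH F N) (ℓ : U3Letters₁₁) (hs : ℓ.Signs)
    (hγ : 0 < θ.γ) (hκ : 0 < ℓ.κ)
    (h9 : NE9 ((objectsOfRecord₁₃ F N θ.toStage13Params ℓ).EA 0) (Window θ.γ) ℓ.κ ℓ.moduli) (hdec : KernelDecayOfRecord₁₃ F N θ.toStage13Params 0 1 ℓ.κ)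
    (h18 : KernelStepRateOfRecord₁₃ F N θ.toStage13Params ℓ.κ ℓ.θ₅ ℓ.C₅)
    (hsign : ∀ b : ℕ → ℝ, (∀ (k : ℕ) (δ : ℝ), 0 < δ → ∃ γ' : ℝ, 0 < γ' ∧ ∀ p : Fin (k + 1) → ℝ, p ∈ HistBox γ' k →
        |(datumOfRecord₁₃SepCoPH F N θ hP).βfun k p - b k| ≤ δ) → ∀ binf : ℝ, Tendsto b atTop (𝓝 binf) → 0 < binf) :
    ∃ (b : ℕ → ℝ) (s A : ℝ),
      (∀ (k : ℕ) (δ : ℝ), 0 < δ → ∃ γ' : ℝ, 0 < γ' ∧ ∀ p : Fin (k + 1) → ℝ, p ∈ HistBox γ' k → |(datumOfRecord₁₃SepCoPH F N θ hP).βfun k p - b k| ≤ δ) ∧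
      0 < s ∧ OneLoopDrift s A b := by
  obtain ⟨b, binf, -, hA, hlim, hdrift⟩ := cornerDrift_record_of_kernelLetters F N θ.toStage13Params ℓ hs hγ hκ h9 hdec h18
  exact ⟨b, binf, _, hA, hsign b hA binf hlim, hdrift⟩

end Record

end YMDAG.N18.CornerDriftOfKernelLetters

end
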